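import Mathlib
import Summits.Ventures.PercRepro2.Defs
import Summits.Ventures.PercRepro2.Harris
import Summits.Ventures.PercRepro2.CoinDefs
import Summits.Ventures.PercRepro2.CoinReverse
import Summits.Ventures.PercRepro2.CoinStarAlg
import Summits.Ventures.PercRepro2.CoinLsmCoreAlg
import Summits.Ventures.PercRepro2.CoinLsmCoreDefs
import Summits.Ventures.PercRepro2.CoinLsmCoreU
import Summits.Ventures.PercRepro2.CoinLsmCoreMainU
import Summits.Ventures.PercRepro2.CoinSquareCkl
import Summits.Ventures.PercRepro2.CoinSquareAlg
import Summits.Ventures.PercRepro2.CoinSquareBracketU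
import Summits.Ventures.PercRepro2.CoinSquareCoreDefs
import Summits.Ventures.PercRepro2.CoinSquareLevels

/-!
# Row 2′DARC at the OR-TAIL: the undirected square core at every head (blind cell PercRepro2,
night-2 g8; proofs/NIGHT2-DARC.md §31)

`darc_of_squareCore`: on a mixed coin system whose closed-in core is the undirected square
`s — p — a — q — s` (four pair-coins `α, β, γ, δ`, nothing else entering `{s, p, q, a}`), with the
tail `u = a` at the OR-vertex and the markers `p, q` on its two routes, row 2′DARC holds at the
arc `a → w` for EVERY head (entries from `s, p, q, a` anywhere, any mixed structure, any target
`t ∉ {s, p, q, a}`, `w ∉ {s, p, q, a}`), under the two non-degeneracy conditions of the cell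
masses.  This is the first core beyond `darc_of_uCellLsmU`: the `u`-cell `{a ∈ S⁺}` is not
∩-closed (the clusters `{s,p,a}` and `{s,q,a}` meet in `{s,a}`, not a cluster), its covariance is
negative, and the bracket is closed by the inequality (OR) of `CoinSquareAlg.lean` instead of
FKG/Holley — the three-factor pairing with the nine cluster-law inequalities of
`CoinSquareCkl.lean`.
-/

namespace Summit.Ventures.PercRepro2.Coin

open Classical

section SquareMain

variable {V : Type*} {E : Type*} [Fintype V] [DecidableEq V] [Fintype E] [DecidableEq E]
  {R : Type*} [Field R] [LinearOrder R] [IsStrictOrderedRing R]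
  {arcs : E → Finset (V × V)} {s p q a w : V} {c₁ c₂ c₃ c₄ : E}

omit [Fintype V] [Fintype E] [DecidableEq E] [LinearOrder R] [IsStrictOrderedRing R] in
/-- A sum over the subsets of `{p, q, a}` (three distinct vertices) written out. -/
lemma sum_powerset_three (hpq : p ≠ q) (hpa : p ≠ a) (hqa : q ≠ a) (f : Finset V → R) :
    ∑ W ∈ ({p, q, a} : Finset V).powerset, f W =
      f ∅ + f {a} + (f {q} + f {q, a}) + (f {p} + f {p, a} + (f {p, q} + f {p, q, a})) := by
  have hp : p ∉ ({q, a} : Finset V) := by simp [hpq, hpa]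
  have hq : q ∉ ({a} : Finset V) := by simp [hqa]
  have ha : a ∉ (∅ : Finset V) := by simp
  rw [Finset.sum_powerset_insert hp, Finset.sum_powerset_insert hq, Finset.sum_powerset_insert hq,
    show ({a} : Finset V) = insert a ∅ from rfl, Finset.sum_powerset_insert ha,
    Finset.sum_powerset_insert ha, Finset.sum_powerset_insert ha, Finset.sum_powerset_insert ha]
  simp only [Finset.powerset_empty, Finset.sum_singleton, Finset.insert_empty]

omit [Fintype V] [Fintype E] [DecidableEq E] [IsStrictOrderedRing R] in
/-- Log-supermodular step `1` of the three-factor pairing on the square. -/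
lemma square_step1 (A : Finset V → R) (hl : ∀ X Y Z U : Finset V, X ∩ Y = Z → X ∪ Y = U →
      A X * A Y ≤ A Z * A U)
    (hpq : p ≠ q) (hpa : p ≠ a) (hqa : q ≠ a) (hqp : q ≠ p) (hap : a ≠ p) (haq : a ≠ q)
    (hwp : w ≠ p) (hwq : w ≠ q) (hwa : w ≠ a) :
    A (insert w {q, a}) * A {p} ≤ A (insert w {p, q, a}) * A ∅ := by
  rw [mul_comm (A (insert w {p, q, a}))]
  refine hl _ _ _ _ ?_ ?_
  · ext x; simp only [Finset.mem_inter, Finset.mem_insert, Finset.mem_singleton,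
      Finset.notMem_empty, iff_false, not_and]
    rintro (rfl | rfl | rfl) <;> [exact hwp; exact hqp; exact hap]
  · ext x; simp only [Finset.mem_union, Finset.mem_insert, Finset.mem_singleton]; aesop

omit [Fintype V] [Fintype E] [DecidableEq E] [IsStrictOrderedRing R] in
/-- Log-supermodular step `2` of the three-factor pairing on the square. -/
lemma square_step2 (A : Finset V → R) (hl : ∀ X Y Z U : Finset V, X ∩ Y = Z → X ∪ Y = U →
      A X * A Y ≤ A Z * A U)
    (hpq : p ≠ q) (hpa : p ≠ a) (hqa : q ≠ a) (hqp : q ≠ p) (hap : a ≠ p) (haq : a ≠ q)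
    (hwp : w ≠ p) (hwq : w ≠ q) (hwa : w ≠ a) :
    A (insert w {q, a}) * A {p, q} ≤ A (insert w {p, q, a}) * A {q} := by
  rw [mul_comm (A (insert w {p, q, a}))]
  refine hl _ _ _ _ ?_ ?_
  · ext x; simp only [Finset.mem_inter, Finset.mem_insert, Finset.mem_singleton]
    constructor
    · rintro ⟨rfl | rfl | rfl, h'⟩
      · rcases h' with rfl | rfl; exact absurd rfl hwp; exact absurd rfl hwq
      · rfl
      · rcases h' with rfl | rfl; exact absurd rfl hap; exact absurd rfl haq
    · rintro rfl; exact ⟨Or.inr (Or.inl rfl), Or.inr rfl⟩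
  · ext x; simp only [Finset.mem_union, Finset.mem_insert, Finset.mem_singleton]; aesop

omit [Fintype V] [Fintype E] [DecidableEq E] [IsStrictOrderedRing R] in
/-- Log-supermodular step `3` of the three-factor pairing on the square. -/
lemma square_step3 (A : Finset V → R) (hl : ∀ X Y Z U : Finset V, X ∩ Y = Z → X ∪ Y = U →
      A X * A Y ≤ A Z * A U)
    (hpq : p ≠ q) (hpa : p ≠ a) (hqa : q ≠ a) (hqp : q ≠ p) (hap : a ≠ p) (haq : a ≠ q)
    (hwp : w ≠ p) (hwq : w ≠ q) (hwa : w ≠ a) :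
    A (insert w {q, a}) * A {p, a} ≤ A (insert w {p, q, a}) * A {a} := by
  rw [mul_comm (A (insert w {p, q, a}))]
  refine hl _ _ _ _ ?_ ?_
  · ext x; simp only [Finset.mem_inter, Finset.mem_insert, Finset.mem_singleton]
    constructor
    · rintro ⟨rfl | rfl | rfl, h'⟩
      · rcases h' with rfl | rfl; exact absurd rfl hwp; exact absurd rfl hwa
      · rcases h' with rfl | rfl; exact absurd rfl hqp; exact absurd rfl hqa
      · rfl
    · rintro rfl; exact ⟨Or.inr (Or.inr rfl), Or.inr rfl⟩
  · ext x; simp only [Finset.mem_union, Finset.mem_insert, Finset.mem_singleton]; aesop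

omit [Fintype V] [Fintype E] [DecidableEq E] [IsStrictOrderedRing R] in
/-- Log-supermodular step `4` of the three-factor pairing on the square. -/
lemma square_step4 (A : Finset V → R) (hl : ∀ X Y Z U : Finset V, X ∩ Y = Z → X ∪ Y = U →
      A X * A Y ≤ A Z * A U)
    (hpq : p ≠ q) (hpa : p ≠ a) (hqa : q ≠ a) (hqp : q ≠ p) (hap : a ≠ p) (haq : a ≠ q)
    (hwp : w ≠ p) (hwq : w ≠ q) (hwa : w ≠ a) :
    A (insert w {q, a}) * A {p, q, a} ≤ A (insert w {p, q, a}) * A {q, a} := by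
  rw [mul_comm (A (insert w {p, q, a}))]
  refine hl _ _ _ _ ?_ ?_
  · ext x; simp only [Finset.mem_inter, Finset.mem_insert, Finset.mem_singleton]
    constructor
    · rintro ⟨rfl | rfl | rfl, h'⟩
      · rcases h' with rfl | rfl | rfl
        · exact absurd rfl hwp
        · exact absurd rfl hwq
        · exact absurd rfl hwa
      · exact Or.inl rfl
      · exact Or.inr rfl
    · rintro (rfl | rfl)
      · exact ⟨Or.inr (Or.inl rfl), Or.inr (Or.inl rfl)⟩
      · exact ⟨Or.inr (Or.inr rfl), Or.inr (Or.inr rfl)⟩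
  · ext x; simp only [Finset.mem_union, Finset.mem_insert, Finset.mem_singleton]; aesop

omit [Fintype V] [Fintype E] [DecidableEq E] [IsStrictOrderedRing R] in
/-- Log-supermodular step `5` of the three-factor pairing on the square. -/
lemma square_step5 (A : Finset V → R) (hl : ∀ X Y Z U : Finset V, X ∩ Y = Z → X ∪ Y = U →
      A X * A Y ≤ A Z * A U)
    (hpq : p ≠ q) (hpa : p ≠ a) (hqa : q ≠ a) (hqp : q ≠ p) (hap : a ≠ p) (haq : a ≠ q)
    (hwp : w ≠ p) (hwq : w ≠ q) (hwa : w ≠ a) :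
    A (insert w {p, a}) * A {q} ≤ A (insert w {p, q, a}) * A ∅ := by
  rw [mul_comm (A (insert w {p, q, a}))]
  refine hl _ _ _ _ ?_ ?_
  · ext x; simp only [Finset.mem_inter, Finset.mem_insert, Finset.mem_singleton,
      Finset.notMem_empty, iff_false, not_and]
    rintro (rfl | rfl | rfl) <;> [exact hwq; exact hpq; exact haq]
  · ext x; simp only [Finset.mem_union, Finset.mem_insert, Finset.mem_singleton]; aesop

omit [Fintype V] [Fintype E] [DecidableEq E] [IsStrictOrderedRing R] in
/-- Log-supermodular step `6` of the three-factor pairing on the square. -/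
lemma square_step6 (A : Finset V → R) (hl : ∀ X Y Z U : Finset V, X ∩ Y = Z → X ∪ Y = U →
      A X * A Y ≤ A Z * A U)
    (hpq : p ≠ q) (hpa : p ≠ a) (hqa : q ≠ a) (hqp : q ≠ p) (hap : a ≠ p) (haq : a ≠ q)
    (hwp : w ≠ p) (hwq : w ≠ q) (hwa : w ≠ a) :
    A (insert w {p, a}) * A {p, q} ≤ A (insert w {p, q, a}) * A {p} := by
  rw [mul_comm (A (insert w {p, q, a}))]
  refine hl _ _ _ _ ?_ ?_
  · ext x; simp only [Finset.mem_inter, Finset.mem_insert, Finset.mem_singleton]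
    constructor
    · rintro ⟨rfl | rfl | rfl, h'⟩
      · rcases h' with rfl | rfl; exact absurd rfl hwp; exact absurd rfl hwq
      · rfl
      · rcases h' with rfl | rfl; exact absurd rfl hap; exact absurd rfl haq
    · rintro rfl; exact ⟨Or.inr (Or.inl rfl), Or.inl rfl⟩
  · ext x; simp only [Finset.mem_union, Finset.mem_insert, Finset.mem_singleton]; aesop

omit [Fintype V] [Fintype E] [DecidableEq E] [IsStrictOrderedRing R] in
/-- Log-supermodular step `7` of the three-factor pairing on the square. -/
lemma square_step7 (A : Finset V → R) (hl : ∀ X Y Z U : Finset V, X ∩ Y = Z → X ∪ Y = U →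
      A X * A Y ≤ A Z * A U)
    (hpq : p ≠ q) (hpa : p ≠ a) (hqa : q ≠ a) (hqp : q ≠ p) (hap : a ≠ p) (haq : a ≠ q)
    (hwp : w ≠ p) (hwq : w ≠ q) (hwa : w ≠ a) :
    A (insert w {p, a}) * A {q, a} ≤ A (insert w {p, q, a}) * A {a} := by
  rw [mul_comm (A (insert w {p, q, a}))]
  refine hl _ _ _ _ ?_ ?_
  · ext x; simp only [Finset.mem_inter, Finset.mem_insert, Finset.mem_singleton]
    constructor
    · rintro ⟨rfl | rfl | rfl, h'⟩
      · rcases h' with rfl | rfl; exact absurd rfl hwq; exact absurd rfl hwa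
      · rcases h' with rfl | rfl; exact absurd rfl hpq; exact absurd rfl hpa
      · rfl
    · rintro rfl; exact ⟨Or.inr (Or.inr rfl), Or.inr rfl⟩
  · ext x; simp only [Finset.mem_union, Finset.mem_insert, Finset.mem_singleton]; aesop

omit [Fintype V] [Fintype E] [DecidableEq E] [IsStrictOrderedRing R] in
/-- Log-supermodular step `8` of the three-factor pairing on the square. -/
lemma square_step8 (A : Finset V → R) (hl : ∀ X Y Z U : Finset V, X ∩ Y = Z → X ∪ Y = U →
      A X * A Y ≤ A Z * A U)
    (hpq : p ≠ q) (hpa : p ≠ a) (hqa : q ≠ a) (hqp : q ≠ p) (hap : a ≠ p) (haq : a ≠ q)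
    (hwp : w ≠ p) (hwq : w ≠ q) (hwa : w ≠ a) :
    A (insert w {p, a}) * A {p, q, a} ≤ A (insert w {p, q, a}) * A {p, a} := by
  rw [mul_comm (A (insert w {p, q, a}))]
  refine hl _ _ _ _ ?_ ?_
  · ext x; simp only [Finset.mem_inter, Finset.mem_insert, Finset.mem_singleton]
    constructor
    · rintro ⟨rfl | rfl | rfl, h'⟩
      · rcases h' with rfl | rfl | rfl
        · exact absurd rfl hwp
        · exact absurd rfl hwq
        · exact absurd rfl hwa
      · exact Or.inl rfl
      · exact Or.inr rfl
    · rintro (rfl | rfl)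
      · exact ⟨Or.inr (Or.inl rfl), Or.inl rfl⟩
      · exact ⟨Or.inr (Or.inr rfl), Or.inr (Or.inr rfl)⟩
  · ext x; simp only [Finset.mem_union, Finset.mem_insert, Finset.mem_singleton]; aesop

omit [Fintype V] in
/-- **(OR) for the square's cluster law** and any head values `A` with the monotonicity and the
eight log-supermodular steps: the nine inequalities `C_kl ≥ 0` are the level probabilities of
`CoinSquareLevels.lean` substituted into `CoinSquareCkl.lean`. -/
theorem SquareCore.or_nonneg (h : SquareCore arcs s p q a c₁ c₂ c₃ c₄) (pr : E → R)
    (hp : IsProbVec pr)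
    (h12 : c₁ ≠ c₂) (h13 : c₁ ≠ c₃) (h14 : c₁ ≠ c₄) (h23 : c₂ ≠ c₃) (h24 : c₂ ≠ c₄) (h34 : c₃ ≠ c₄)
    (A : Finset V → R) (hA0 : ∀ X, 0 ≤ A X)
    (hAq_le : A {q} ≤ A ∅) (hAqa_le : A {q, a} ≤ A {q}) (hAp_le : A {p} ≤ A ∅) (hApa_le : A {p, a} ≤ A {p})
    (hAa_le : A {a} ≤ A ∅)
    (e1 : A (insert w {q, a}) * A {p} ≤ A (insert w {p, q, a}) * A ∅)
    (e2 : A (insert w {q, a}) * A {p, q} ≤ A (insert w {p, q, a}) * A {q})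
    (e3 : A (insert w {q, a}) * A {p, a} ≤ A (insert w {p, q, a}) * A {a})
    (e4 : A (insert w {q, a}) * A {p, q, a} ≤ A (insert w {p, q, a}) * A {q, a})
    (e5 : A (insert w {p, a}) * A {q} ≤ A (insert w {p, q, a}) * A ∅)
    (e6 : A (insert w {p, a}) * A {p, q} ≤ A (insert w {p, q, a}) * A {p})
    (e7 : A (insert w {p, a}) * A {q, a} ≤ A (insert w {p, q, a}) * A {a})
    (e8 : A (insert w {p, a}) * A {p, q, a} ≤ A (insert w {p, q, a}) * A {p, a}) :
    0 ≤ (prob pr (coreLevel arcs s {p, q, a} {p, q, a}) * A (insert w {p, q, a})) * (prob pr (coreLevel arcs s {p, q, a} ∅) * A ∅ + prob pr (coreLevel arcs s {p, q, a} {q}) * A {q} + prob pr (coreLevel arcs s {p, q, a} {q, a}) * A {q, a}) * (prob pr (coreLevel arcs s {p, q, a} ∅) * A ∅ + prob pr (coreLevel arcs s {p, q, a} {p}) * A {p} + prob pr (coreLevel arcs s {p, q, a} {p, a}) * A {p, a}) - (prob pr (coreLevel arcs s {p, q, a} {q, a}) * A (insert w {q, a})) * (prob pr (coreLevel arcs s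 {p, q, a} {p}) * A {p} + prob pr (coreLevel arcs s {p, q, a} {p, q}) * A {p, q} + prob pr (coreLevel arcs s {p, q, a} {p, a}) * A {p, a} + prob pr (coreLevel arcs s {p, q, a} {p, q, a}) * A {p, q, a}) * (prob pr (coreLevel arcs s {p, q, a} ∅) * A ∅ + prob pr (coreLevel arcs s {p, q, a} {p}) * A {p} + prob pr (coreLevel arcs s {p, q, a} {p, a}) * A {p, a}) - (prob pr (coreLevel arcs s {p, q, a} {p, a}) * A (insert w {p, a})) * (prob pr (coreLevel arcs s {p, q, a} {q}) * A {q} + prob pr (coreLevel arcs s {p, q, a} {p, q}) * A {p, q} + prob pr (coreLevel arcs s {p, q, a} {q, a}) * A {q, a} + prob pr (coreLevel arcs s {p, q, a} {p, q, a}) * A {p, q, a}) * (prob pr (coreLevel arcs s {p, q, a} ∅) * A ∅ + prob pr (coreLevel arcs s {p, q, a} {q}) * A {q} + prob pr (coreLevel arcs s {p, q, a} {q, a}) * A {q, a}) := by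
  have hC00 : 0 ≤ prob pr (coreLevel arcs s {p, q, a} {p, q, a}) * prob pr (coreLevel arcs s {p, q, a} ∅) * prob pr (coreLevel arcs s {p, q, a} ∅) - prob pr (coreLevel arcs s {p, q, a} {q, a}) * (prob pr (coreLevel arcs s {p, q, a} {p}) + prob pr (coreLevel arcs s {p, q, a} {p, a})) * prob pr (coreLevel arcs s {p, q, a} ∅) - prob pr (coreLevel arcs s {p, q, a} {p, a}) * (prob pr (coreLevel arcs s {p, q, a} {q}) + prob pr (coreLevel arcs s {p, q, a} {q, a})) * prob pr (coreLevel arcs s {p, q, a} ∅) := by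
    simp only [h.nu_empty pr h12 h13 h14 h23 h24 h34, h.nu_p pr h12 h13 h14 h23 h24 h34, h.nu_q pr h12 h13 h14 h23 h24 h34, h.nu_pa pr h12 h13 h14 h23 h24 h34, h.nu_qa pr h12 h13 h14 h23 h24 h34, h.nu_pqa pr h12 h13 h14 h23 h24 h34]
    have := square_C00_nonneg (pr c₁) (1 - pr c₁) (pr c₂) (1 - pr c₂) (pr c₃) (1 - pr c₃) (pr c₄) (1 - pr c₄)
      (hp.nonneg c₁) (sub_nonneg.2 (hp.le_one c₁)) (hp.nonneg c₂) (sub_nonneg.2 (hp.le_one c₂))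
      (hp.nonneg c₃) (sub_nonneg.2 (hp.le_one c₃)) (hp.nonneg c₄) (sub_nonneg.2 (hp.le_one c₄))
    linarith
  have hC01 : 0 ≤ prob pr (coreLevel arcs s {p, q, a} {p, q, a}) * prob pr (coreLevel arcs s {p, q, a} ∅) * (prob pr (coreLevel arcs s {p, q, a} ∅) + prob pr (coreLevel arcs s {p, q, a} {p})) - prob pr (coreLevel arcs s {p, q, a} {q, a}) * (prob pr (coreLevel arcs s {p, q, a} {p}) + prob pr (coreLevel arcs s {p, q, a} {p, a})) * (prob pr (coreLevel arcs s {p, q, a} ∅) + prob pr (coreLevel arcs s {p, q, a} {p})) - prob pr (coreLevel arcs s {p, q, a} {p, a}) * (prob pr (coreLevel arcs s {p, q, a} {q}) + prob pr (coreLevel arcs s {p, q, a} {q, a}) + prob pr (coreLevel arcs s {p, q, a} {p, q})) * prob pr (coreLevel arcs s {p, q, a} ∅) := by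
    simp only [h.nu_empty pr h12 h13 h14 h23 h24 h34, h.nu_p pr h12 h13 h14 h23 h24 h34, h.nu_q pr h12 h13 h14 h23 h24 h34, h.nu_pa pr h12 h13 h14 h23 h24 h34, h.nu_qa pr h12 h13 h14 h23 h24 h34, h.nu_pqa pr h12 h13 h14 h23 h24 h34, h.nu_pq pr h12 h13 h14 h23 h24 h34]
    have := square_C01_nonneg (pr c₁) (1 - pr c₁) (pr c₂) (1 - pr c₂) (pr c₃) (1 - pr c₃) (pr c₄) (1 - pr c₄)
      (hp.nonneg c₁) (sub_nonneg.2 (hp.le_one c₁)) (hp.nonneg c₂) (sub_nonneg.2 (hp.le_one c₂))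
      (hp.nonneg c₃) (sub_nonneg.2 (hp.le_one c₃)) (hp.nonneg c₄) (sub_nonneg.2 (hp.le_one c₄))
    linarith
  have hC02 : 0 ≤ prob pr (coreLevel arcs s {p, q, a} {p, q, a}) * prob pr (coreLevel arcs s {p, q, a} ∅) * (prob pr (coreLevel arcs s {p, q, a} ∅) + prob pr (coreLevel arcs s {p, q, a} {p}) + prob pr (coreLevel arcs s {p, q, a} {p, a})) - prob pr (coreLevel arcs s {p, q, a} {q, a}) * (prob pr (coreLevel arcs s {p, q, a} {p}) + prob pr (coreLevel arcs s {p, q, a} {p, a})) * (prob pr (coreLevel arcs s {p, q, a} ∅) + prob pr (coreLevel arcs s {p, q, a} {p}) + prob pr (coreLevel arcs s {p, q, a} {p, a})) - prob pr (coreLevel arcs s {p, q, a} {p, a}) * (prob pr (coreLevel arcs s {p, q, a} {q}) + prob pr (coreLevel arcs s {p, q, a} {q, a}) + prob pr (coreLevel arcs s {p, q, a} {p, q}) + prob pr (coreLevel arcs s {p, q, a} {p, q, a})) * prob pr (coreLevel arcs s {p, q, a} ∅) := by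
    simp only [h.nu_empty pr h12 h13 h14 h23 h24 h34, h.nu_p pr h12 h13 h14 h23 h24 h34, h.nu_q pr h12 h13 h14 h23 h24 h34, h.nu_pa pr h12 h13 h14 h23 h24 h34, h.nu_qa pr h12 h13 h14 h23 h24 h34, h.nu_pqa pr h12 h13 h14 h23 h24 h34, h.nu_pq pr h12 h13 h14 h23 h24 h34]
    have := square_C02_nonneg (pr c₁) (1 - pr c₁) (pr c₂) (1 - pr c₂) (pr c₃) (1 - pr c₃) (pr c₄) (1 - pr c₄)
      (hp.nonneg c₁) (sub_nonneg.2 (hp.le_one c₁)) (hp.nonneg c₂) (sub_nonneg.2 (hp.le_one c₂))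
      (hp.nonneg c₃) (sub_nonneg.2 (hp.le_one c₃)) (hp.nonneg c₄) (sub_nonneg.2 (hp.le_one c₄))
    linarith
  have hC10 : 0 ≤ prob pr (coreLevel arcs s {p, q, a} {p, q, a}) * (prob pr (coreLevel arcs s {p, q, a} ∅) + prob pr (coreLevel arcs s {p, q, a} {q})) * prob pr (coreLevel arcs s {p, q, a} ∅) - prob pr (coreLevel arcs s {p, q, a} {q, a}) * (prob pr (coreLevel arcs s {p, q, a} {p}) + prob pr (coreLevel arcs s {p, q, a} {p, a}) + prob pr (coreLevel arcs s {p, q, a} {p, q})) * prob pr (coreLevel arcs s {p, q, a} ∅) - prob pr (coreLevel arcs s {p, q, a} {p, a}) * (prob pr (coreLevel arcs s {p, q, a} {q}) + prob pr (coreLevel arcs s {p, q, a} {q, a})) * (prob pr (coreLevel arcs s {p, q, a} ∅) + prob pr (coreLevel arcs s {p, q, a} {q})) := by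
    simp only [h.nu_empty pr h12 h13 h14 h23 h24 h34, h.nu_p pr h12 h13 h14 h23 h24 h34, h.nu_q pr h12 h13 h14 h23 h24 h34, h.nu_pa pr h12 h13 h14 h23 h24 h34, h.nu_qa pr h12 h13 h14 h23 h24 h34, h.nu_pqa pr h12 h13 h14 h23 h24 h34, h.nu_pq pr h12 h13 h14 h23 h24 h34]
    have := square_C10_nonneg (pr c₁) (1 - pr c₁) (pr c₂) (1 - pr c₂) (pr c₃) (1 - pr c₃) (pr c₄) (1 - pr c₄)
      (hp.nonneg c₁) (sub_nonneg.2 (hp.le_one c₁)) (hp.nonneg c₂) (sub_nonneg.2 (hp.le_one c₂))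
      (hp.nonneg c₃) (sub_nonneg.2 (hp.le_one c₃)) (hp.nonneg c₄) (sub_nonneg.2 (hp.le_one c₄))
    linarith
  have hC11 : 0 ≤ prob pr (coreLevel arcs s {p, q, a} {p, q, a}) * (prob pr (coreLevel arcs s {p, q, a} ∅) + prob pr (coreLevel arcs s {p, q, a} {q})) * (prob pr (coreLevel arcs s {p, q, a} ∅) + prob pr (coreLevel arcs s {p, q, a} {p})) - prob pr (coreLevel arcs s {p, q, a} {q, a}) * (prob pr (coreLevel arcs s {p, q, a} {p}) + prob pr (coreLevel arcs s {p, q, a} {p, a}) + prob pr (coreLevel arcs s {p, q, a} {p, q})) * (prob pr (coreLevel arcs s {p, q, a} ∅) + prob pr (coreLevel arcs s {p, q, a} {p})) - prob pr (coreLevel arcs s {p, q, a} {p, a}) * (prob pr (coreLevel arcs s {p, q, a} {q}) + prob pr (coreLevel arcs s {p, q, a} {q, a}) + prob pr (coreLevel arcs s {p, q, a} {p, q})) * (prob pr (coreLevel arcs s {p, q, a} ∅) + prob pr (coreLevel arcs s {p, q, a} {q})) := by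
    simp only [h.nu_empty pr h12 h13 h14 h23 h24 h34, h.nu_p pr h12 h13 h14 h23 h24 h34, h.nu_q pr h12 h13 h14 h23 h24 h34, h.nu_pa pr h12 h13 h14 h23 h24 h34, h.nu_qa pr h12 h13 h14 h23 h24 h34, h.nu_pqa pr h12 h13 h14 h23 h24 h34, h.nu_pq pr h12 h13 h14 h23 h24 h34]
    have := square_C11_nonneg (pr c₁) (1 - pr c₁) (pr c₂) (1 - pr c₂) (pr c₃) (1 - pr c₃) (pr c₄) (1 - pr c₄)
      (hp.nonneg c₁) (sub_nonneg.2 (hp.le_one c₁)) (hp.nonneg c₂) (sub_nonneg.2 (hp.le_one c₂))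
      (hp.nonneg c₃) (sub_nonneg.2 (hp.le_one c₃)) (hp.nonneg c₄) (sub_nonneg.2 (hp.le_one c₄))
    linarith
  have hC12 : 0 ≤ prob pr (coreLevel arcs s {p, q, a} {p, q, a}) * (prob pr (coreLevel arcs s {p, q, a} ∅) + prob pr (coreLevel arcs s {p, q, a} {q})) * (prob pr (coreLevel arcs s {p, q, a} ∅) + prob pr (coreLevel arcs s {p, q, a} {p}) + prob pr (coreLevel arcs s {p, q, a} {p, a})) - prob pr (coreLevel arcs s {p, q, a} {q, a}) * (prob pr (coreLevel arcs s {p, q, a} {p}) + prob pr (coreLevel arcs s {p, q, a} {p, a}) + prob pr (coreLevel arcs s {p, q, a} {p, q})) * (prob pr (coreLevel arcs s {p, q, a} ∅) + prob pr (coreLevel arcs s {p, q, a} {p}) + prob pr (coreLevel arcs s {p, q, a} {p, a})) - prob pr (coreLevel arcs s {p, q, a} {p, a}) * (prob pr (coreLevel arcs s {p, q, a} {q}) + prob pr (coreLevel arcs s {p, q, a} {q, a}) + prob pr (coreLevel arcs s {p, q, a} {p, q}) + prob pr (coreLevel arcs s {p, q, a} {p, q, a})) * (prob pr (coreLevel arcs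 s {p, q, a} ∅) + prob pr (coreLevel arcs s {p, q, a} {q})) := by
    simp only [h.nu_empty pr h12 h13 h14 h23 h24 h34, h.nu_p pr h12 h13 h14 h23 h24 h34, h.nu_q pr h12 h13 h14 h23 h24 h34, h.nu_pa pr h12 h13 h14 h23 h24 h34, h.nu_qa pr h12 h13 h14 h23 h24 h34, h.nu_pqa pr h12 h13 h14 h23 h24 h34, h.nu_pq pr h12 h13 h14 h23 h24 h34]
    have := square_C12_nonneg (pr c₁) (1 - pr c₁) (pr c₂) (1 - pr c₂) (pr c₃) (1 - pr c₃) (pr c₄) (1 - pr c₄)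
      (hp.nonneg c₁) (sub_nonneg.2 (hp.le_one c₁)) (hp.nonneg c₂) (sub_nonneg.2 (hp.le_one c₂))
      (hp.nonneg c₃) (sub_nonneg.2 (hp.le_one c₃)) (hp.nonneg c₄) (sub_nonneg.2 (hp.le_one c₄))
    linarith
  have hC20 : 0 ≤ prob pr (coreLevel arcs s {p, q, a} {p, q, a}) * (prob pr (coreLevel arcs s {p, q, a} ∅) + prob pr (coreLevel arcs s {p, q, a} {q}) + prob pr (coreLevel arcs s {p, q, a} {q, a})) * prob pr (coreLevel arcs s {p, q, a} ∅) - prob pr (coreLevel arcs s {p, q, a} {q, a}) * (prob pr (coreLevel arcs s {p, q, a} {p}) + prob pr (coreLevel arcs s {p, q, a} {p, a}) + prob pr (coreLevel arcs s {p, q, a} {p, q}) + prob pr (coreLevel arcs s {p, q, a} {p, q, a})) * prob pr (coreLevel arcs s {p, q, a} ∅) - prob pr (coreLevel arcs s {p, q, a} {p, a}) * (prob pr (coreLevel arcs s {p, q, a} {q}) + prob pr (coreLevel arcs s {p, q, a} {q, a})) * (prob pr (coreLevel arcs s {p, q, a} ∅) + prob pr (coreLevel arcs s {p, q, a} {q})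 + prob pr (coreLevel arcs s {p, q, a} {q, a})) := by
    simp only [h.nu_empty pr h12 h13 h14 h23 h24 h34, h.nu_p pr h12 h13 h14 h23 h24 h34, h.nu_q pr h12 h13 h14 h23 h24 h34, h.nu_pa pr h12 h13 h14 h23 h24 h34, h.nu_qa pr h12 h13 h14 h23 h24 h34, h.nu_pqa pr h12 h13 h14 h23 h24 h34, h.nu_pq pr h12 h13 h14 h23 h24 h34]
    have := square_C20_nonneg (pr c₁) (1 - pr c₁) (pr c₂) (1 - pr c₂) (pr c₃) (1 - pr c₃) (pr c₄) (1 - pr c₄)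
      (hp.nonneg c₁) (sub_nonneg.2 (hp.le_one c₁)) (hp.nonneg c₂) (sub_nonneg.2 (hp.le_one c₂))
      (hp.nonneg c₃) (sub_nonneg.2 (hp.le_one c₃)) (hp.nonneg c₄) (sub_nonneg.2 (hp.le_one c₄))
    linarith
  have hC21 : 0 ≤ prob pr (coreLevel arcs s {p, q, a} {p, q, a}) * (prob pr (coreLevel arcs s {p, q, a} ∅) + prob pr (coreLevel arcs s {p, q, a} {q}) + prob pr (coreLevel arcs s {p, q, a} {q, a})) * (prob pr (coreLevel arcs s {p, q, a} ∅) + prob pr (coreLevel arcs s {p, q, a} {p})) - prob pr (coreLevel arcs s {p, q, a} {q, a}) * (prob pr (coreLevel arcs s {p, q, a} {p}) + prob pr (coreLevel arcs s {p, q, a} {p, a}) + prob pr (coreLevel arcs s {p, q, a} {p, q}) + prob pr (coreLevel arcs s {p, q, a} {p, q, a})) * (prob pr (coreLevel arcs s {p, q, a} ∅) + prob pr (coreLevel arcs s {p, q, a} {p})) - prob pr (coreLevel arcs s {p, q, a} {p, a}) * (prob pr (coreLevel arcs s {p, q, a} {q}) + prob pr (coreLevel arcs s {p, q, a} {q, a})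 + prob pr (coreLevel arcs s {p, q, a} {p, q})) * (prob pr (coreLevel arcs s {p, q, a} ∅) + prob pr (coreLevel arcs s {p, q, a} {q}) + prob pr (coreLevel arcs s {p, q, a} {q, a})) := by
    simp only [h.nu_empty pr h12 h13 h14 h23 h24 h34, h.nu_p pr h12 h13 h14 h23 h24 h34, h.nu_q pr h12 h13 h14 h23 h24 h34, h.nu_pa pr h12 h13 h14 h23 h24 h34, h.nu_qa pr h12 h13 h14 h23 h24 h34, h.nu_pqa pr h12 h13 h14 h23 h24 h34, h.nu_pq pr h12 h13 h14 h23 h24 h34]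
    have := square_C21_nonneg (pr c₁) (1 - pr c₁) (pr c₂) (1 - pr c₂) (pr c₃) (1 - pr c₃) (pr c₄) (1 - pr c₄)
      (hp.nonneg c₁) (sub_nonneg.2 (hp.le_one c₁)) (hp.nonneg c₂) (sub_nonneg.2 (hp.le_one c₂))
      (hp.nonneg c₃) (sub_nonneg.2 (hp.le_one c₃)) (hp.nonneg c₄) (sub_nonneg.2 (hp.le_one c₄))
    linarith
  have hC22 : 0 ≤ prob pr (coreLevel arcs s {p, q, a} {p, q, a}) * (prob pr (coreLevel arcs s {p, q, a} ∅) + prob pr (coreLevel arcs s {p, q, a} {q}) + prob pr (coreLevel arcs s {p, q, a} {q, a})) * (prob pr (coreLevel arcs s {p, q, a} ∅) + prob pr (coreLevel arcs s {p, q, a} {p}) + prob pr (coreLevel arcs s {p, q, a} {p, a})) - prob pr (coreLevel arcs s {p, q, a} {q, a}) * (prob pr (coreLevel arcs s {p, q, a} {p}) + prob pr (coreLevel arcs s {p, q, a} {p, a}) + prob pr (coreLevel arcs s {p, q, a} {p, q}) + prob pr (coreLevel arcs s {p, q, a} {p, q, a})) * (prob pr (coreLevel arcs s {p, q, a} ∅)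 + prob pr (coreLevel arcs s {p, q, a} {p}) + prob pr (coreLevel arcs s {p, q, a} {p, a})) - prob pr (coreLevel arcs s {p, q, a} {p, a}) * (prob pr (coreLevel arcs s {p, q, a} {q}) + prob pr (coreLevel arcs s {p, q, a} {q, a}) + prob pr (coreLevel arcs s {p, q, a} {p, q}) + prob pr (coreLevel arcs s {p, q, a} {p, q, a})) * (prob pr (coreLevel arcs s {p, q, a} ∅) + prob pr (coreLevel arcs s {p, q, a} {q}) + prob pr (coreLevel arcs s {p, q, a} {q, a})) := by
    simp only [h.nu_empty pr h12 h13 h14 h23 h24 h34, h.nu_p pr h12 h13 h14 h23 h24 h34, h.nu_q pr h12 h13 h14 h23 h24 h34, h.nu_pa pr h12 h13 h14 h23 h24 h34, h.nu_qa pr h12 h13 h14 h23 h24 h34, h.nu_pqa pr h12 h13 h14 h23 h24 h34, h.nu_pq pr h12 h13 h14 h23 h24 h34]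
    have := square_C22_nonneg (pr c₁) (1 - pr c₁) (pr c₂) (1 - pr c₂) (pr c₃) (1 - pr c₃) (pr c₄) (1 - pr c₄)
      (hp.nonneg c₁) (sub_nonneg.2 (hp.le_one c₁)) (hp.nonneg c₂) (sub_nonneg.2 (hp.le_one c₂))
      (hp.nonneg c₃) (sub_nonneg.2 (hp.le_one c₃)) (hp.nonneg c₄) (sub_nonneg.2 (hp.le_one c₄))
    linarith
  exact square_or_of_Ckl (prob pr (coreLevel arcs s {p, q, a} ∅)) (prob pr (coreLevel arcs s {p, q, a} {p})) (prob pr (coreLevel arcs s {p, q, a} {q})) (prob pr (coreLevel arcs s {p, q, a} {p, q})) (prob pr (coreLevel arcs s {p, q, a} {p, a})) (prob pr (coreLevel arcs s {p, q, a} {q, a})) (prob pr (coreLevel arcs s {p, q, a} {p, q, a}))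
    (prob_nonneg hp _) (prob_nonneg hp _) (prob_nonneg hp _) (prob_nonneg hp _) (prob_nonneg hp _) (prob_nonneg hp _) (prob_nonneg hp _)
    (A ∅) (A {p}) (A {q}) (A {p, q}) (A {p, a}) (A {q, a}) (A {p, q, a}) (A {a}) (A (insert w {p, a}))
    (A (insert w {q, a})) (A (insert w {p, q, a}))
    (hA0 _) (hA0 _) (hA0 _) (hA0 _) (hA0 _) (hA0 _) hAq_le hAqa_le hAp_le hApa_le hAa_le
    e1 e2 e3 e4 e5 e6 e7 e8 hC00 hC01 hC02 hC10 hC11 hC12 hC20 hC21 hC22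

omit [Fintype V] [LinearOrder R] [IsStrictOrderedRing R] in
/-- The `u`-cell bracket on the core sums of the square (`C = {p, q, a}`, tail `a`, markers
`p, q`) equals the explicit seven-cluster expression: the sums expand over the eight subsets,
`ν({a}) = 0`, the indicators evaluate. -/
theorem SquareCore.bracket_sums_eq (h : SquareCore arcs s p q a c₁ c₂ c₃ c₄) (pr : E → R)
    (h12 : c₁ ≠ c₂) (h13 : c₁ ≠ c₃) (h14 : c₁ ≠ c₄) (h23 : c₂ ≠ c₃) (h24 : c₂ ≠ c₄) (h34 : c₃ ≠ c₄)
    (t : V) :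
    ((∑ W ∈ ({p, q, a} : Finset V).powerset, prob pr (coreLevel arcs s {p, q, a} W) * notMemWt a W * prob pr (coreAvoidEvent arcs s t {p, q, a} W)) + (∑ W ∈ ({p, q, a} : Finset V).powerset, prob pr (coreLevel arcs s {p, q, a} W) * memWt a W * prob pr (coreAvoidEvent arcs s t {p, q, a} W))) ^ 2 * ((∑ W ∈ ({p, q, a} : Finset V).powerset, prob pr (coreLevel arcs s {p, q, a} W) * memWt a W * prob pr (coreAvoidEvent arcs s t {p, q, a} (insert w W))) * (∑ W ∈ ({p, q, a} : Finset V).powerset, prob pr (coreLevel arcs s {p, q, a} W) * memWt a W * prob pr (coreAvoidEvent arcs s t {p, q, a} (insert w W)) * ((if p ∈ W then (1 : R) else 0) * (if q ∈ W then (1 : R) else 0))) - (∑ W ∈ ({p, q, a} : Finset V).powerset, prob pr (coreLevel arcs s {p, q, a} W) * memWt a W * prob pr (coreAvoidEvent arcs s t {p, q, a} (insert w W)) * (if p ∈ W then (1 : R) else 0)) * (∑ W ∈ ({p, q, a} : Finset V).powerset, prob pr (coreLevel arcs s {p, q, a} W) * memWt a W * prob pr (coreAvoidEvent arcs s t {p,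 q, a} (insert w W)) * (if q ∈ W then (1 : R) else 0)))
      + (((∑ W ∈ ({p, q, a} : Finset V).powerset, prob pr (coreLevel arcs s {p, q, a} W) * notMemWt a W * prob pr (coreAvoidEvent arcs s t {p, q, a} W)) + (∑ W ∈ ({p, q, a} : Finset V).powerset, prob pr (coreLevel arcs s {p, q, a} W) * memWt a W * prob pr (coreAvoidEvent arcs s t {p, q, a} W))) * (∑ W ∈ ({p, q, a} : Finset V).powerset, prob pr (coreLevel arcs s {p, q, a} W) * memWt a W * prob pr (coreAvoidEvent arcs s t {p, q, a} (insert w W)) * (if p ∈ W then (1 : R) else 0)) - ((∑ W ∈ ({p, q, a} : Finset V).powerset, prob pr (coreLevel arcs s {p, q, a} W) * notMemWt a W * prob pr (coreAvoidEvent arcs s t {p, q, a} W) * (if p ∈ W then (1 : R) else 0)) + (∑ W ∈ ({p, q, a} : Finset V).powerset, prob pr (coreLevel arcs s {p, q, a} W) * memWt a W * prob pr (coreAvoidEvent arcs s t {p, q, a} W) * (if p ∈ W then (1 : R) else 0))) * (∑ W ∈ ({p, q, a} : Finset V).powerset, prob pr (coreLevel arcs s {p, q, a} W) * memWt a W * prob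 pr (coreAvoidEvent arcs s t {p, q, a} (insert w W))))
        * (((∑ W ∈ ({p, q, a} : Finset V).powerset, prob pr (coreLevel arcs s {p, q, a} W) * notMemWt a W * prob pr (coreAvoidEvent arcs s t {p, q, a} W)) + (∑ W ∈ ({p, q, a} : Finset V).powerset, prob pr (coreLevel arcs s {p, q, a} W) * memWt a W * prob pr (coreAvoidEvent arcs s t {p, q, a} W))) * (∑ W ∈ ({p, q, a} : Finset V).powerset, prob pr (coreLevel arcs s {p, q, a} W) * memWt a W * prob pr (coreAvoidEvent arcs s t {p, q, a} (insert w W)) * (if q ∈ W then (1 : R) else 0)) - ((∑ W ∈ ({p, q, a} : Finset V).powerset, prob pr (coreLevel arcs s {p, q, a} W) * notMemWt a W * prob pr (coreAvoidEvent arcs s t {p, q, a} W) * (if q ∈ W then (1 : R) else 0)) + (∑ W ∈ ({p, q, a} : Finset V).powerset, prob pr (coreLevel arcs s {p, q, a} W) * memWt a W * prob pr (coreAvoidEvent arcs s t {p, q, a} W) * (if q ∈ W then (1 : R) else 0))) * (∑ W ∈ ({p, q, a} : Finset V).powerset, prob pr (coreLevel arcs s {p, q, a} W) * memWt a W * prob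 pr (coreAvoidEvent arcs s t {p, q, a} (insert w W))))
    = ((prob pr (coreLevel arcs s {p, q, a} ∅) * prob pr (coreAvoidEvent arcs s t {p, q, a} ∅) + prob pr (coreLevel arcs s {p, q, a} {p}) * prob pr (coreAvoidEvent arcs s t {p, q, a} {p}) + prob pr (coreLevel arcs s {p, q, a} {q}) * prob pr (coreAvoidEvent arcs s t {p, q, a} {q}) + prob pr (coreLevel arcs s {p, q, a} {p, q}) * prob pr (coreAvoidEvent arcs s t {p, q, a} {p, q})) + (prob pr (coreLevel arcs s {p, q, a} {p, a}) * prob pr (coreAvoidEvent arcs s t {p, q, a} {p, a}) + prob pr (coreLevel arcs s {p, q, a} {q, a}) * prob pr (coreAvoidEvent arcs s t {p, q, a} {q, a}) + prob pr (coreLevel arcs s {p, q, a} {p, q, a}) * prob pr (coreAvoidEvent arcs s t {p, q, a} {p, q, a}))) ^ 2 * (((prob pr (coreLevel arcs s {p, q, a} {p, a}) * prob pr (coreAvoidEvent arcs s t {p, q, a} (insert w {p, a}))) + (prob pr (coreLevel arcs s {p, q, a} {q, a}) * prob pr (coreAvoidEvent arcs s t {p, q, a} (insert w {q, a}))) + (prob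 pr (coreLevel arcs s {p, q, a} {p, q, a}) * prob pr (coreAvoidEvent arcs s t {p, q, a} (insert w {p, q, a})))) * (prob pr (coreLevel arcs s {p, q, a} {p, q, a}) * prob pr (coreAvoidEvent arcs s t {p, q, a} (insert w {p, q, a}))) - ((prob pr (coreLevel arcs s {p, q, a} {p, a}) * prob pr (coreAvoidEvent arcs s t {p, q, a} (insert w {p, a}))) + (prob pr (coreLevel arcs s {p, q, a} {p, q, a}) * prob pr (coreAvoidEvent arcs s t {p, q, a} (insert w {p, q, a})))) * ((prob pr (coreLevel arcs s {p, q, a} {q, a}) * prob pr (coreAvoidEvent arcs s t {p, q, a} (insert w {q, a}))) + (prob pr (coreLevel arcs s {p, q, a} {p, q, a}) * prob pr (coreAvoidEvent arcs s t {p, q, a} (insert w {p, q, a}))))) + (((prob pr (coreLevel arcs s {p, q, a} ∅) * prob pr (coreAvoidEvent arcs s t {p, q, a} ∅) + prob pr (coreLevel arcs s {p, q, a} {p}) * prob pr (coreAvoidEvent arcs s t {p, q, a} {p}) + prob pr (coreLevel arcs s {p, q, a} {q}) * prob pr (coreAvoidEvent arcs s t {p, q, a} {q}) + prob pr (coreLevel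 arcs s {p, q, a} {p, q}) * prob pr (coreAvoidEvent arcs s t {p, q, a} {p, q})) + (prob pr (coreLevel arcs s {p, q, a} {p, a}) * prob pr (coreAvoidEvent arcs s t {p, q, a} {p, a}) + prob pr (coreLevel arcs s {p, q, a} {q, a}) * prob pr (coreAvoidEvent arcs s t {p, q, a} {q, a}) + prob pr (coreLevel arcs s {p, q, a} {p, q, a}) * prob pr (coreAvoidEvent arcs s t {p, q, a} {p, q, a}))) * ((prob pr (coreLevel arcs s {p, q, a} {p, a}) * prob pr (coreAvoidEvent arcs s t {p, q, a} (insert w {p, a}))) + (prob pr (coreLevel arcs s {p, q, a} {p, q, a}) * prob pr (coreAvoidEvent arcs s t {p, q, a} (insert w {p, q, a})))) - ((prob pr (coreLevel arcs s {p, q, a} {p}) * prob pr (coreAvoidEvent arcs s t {p, q, a} {p}) + prob pr (coreLevel arcs s {p, q, a} {p, q}) * prob pr (coreAvoidEvent arcs s t {p, q, a} {p, q})) + (prob pr (coreLevel arcs s {p, q, a} {p, a}) * prob pr (coreAvoidEvent arcs s t {p, q, a} {p, a}) + prob pr (coreLevel arcs s {p, q, a} {p, q, a}) * prob pr (coreAvoidEvent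 arcs s t {p, q, a} {p, q, a}))) * ((prob pr (coreLevel arcs s {p, q, a} {p, a}) * prob pr (coreAvoidEvent arcs s t {p, q, a} (insert w {p, a}))) + (prob pr (coreLevel arcs s {p, q, a} {q, a}) * prob pr (coreAvoidEvent arcs s t {p, q, a} (insert w {q, a}))) + (prob pr (coreLevel arcs s {p, q, a} {p, q, a}) * prob pr (coreAvoidEvent arcs s t {p, q, a} (insert w {p, q, a}))))) * (((prob pr (coreLevel arcs s {p, q, a} ∅) * prob pr (coreAvoidEvent arcs s t {p, q, a} ∅) + prob pr (coreLevel arcs s {p, q, a} {p}) * prob pr (coreAvoidEvent arcs s t {p, q, a} {p}) + prob pr (coreLevel arcs s {p, q, a} {q}) * prob pr (coreAvoidEvent arcs s t {p, q, a} {q}) + prob pr (coreLevel arcs s {p, q, a} {p, q}) * prob pr (coreAvoidEvent arcs s t {p, q, a} {p, q})) + (prob pr (coreLevel arcs s {p, q, a} {p, a}) * prob pr (coreAvoidEvent arcs s t {p, q, a} {p, a}) + prob pr (coreLevel arcs s {p, q, a} {q, a}) * prob pr (coreAvoidEvent arcs s t {p, q, a} {q, a}) + prob pr (coreLevel arcs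 s {p, q, a} {p, q, a}) * prob pr (coreAvoidEvent arcs s t {p, q, a} {p, q, a}))) * ((prob pr (coreLevel arcs s {p, q, a} {q, a}) * prob pr (coreAvoidEvent arcs s t {p, q, a} (insert w {q, a}))) + (prob pr (coreLevel arcs s {p, q, a} {p, q, a}) * prob pr (coreAvoidEvent arcs s t {p, q, a} (insert w {p, q, a})))) - ((prob pr (coreLevel arcs s {p, q, a} {q}) * prob pr (coreAvoidEvent arcs s t {p, q, a} {q}) + prob pr (coreLevel arcs s {p, q, a} {p, q}) * prob pr (coreAvoidEvent arcs s t {p, q, a} {p, q})) + (prob pr (coreLevel arcs s {p, q, a} {q, a}) * prob pr (coreAvoidEvent arcs s t {p, q, a} {q, a}) + prob pr (coreLevel arcs s {p, q, a} {p, q, a}) * prob pr (coreAvoidEvent arcs s t {p, q, a} {p, q, a}))) * ((prob pr (coreLevel arcs s {p, q, a} {p, a}) * prob pr (coreAvoidEvent arcs s t {p, q, a} (insert w {p, a}))) + (prob pr (coreLevel arcs s {p, q, a} {q, a}) * prob pr (coreAvoidEvent arcs s t {p, q, a} (insert w {q, a}))) + (prob pr (coreLevel arcs s {p, q, a} {p,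 q, a}) * prob pr (coreAvoidEvent arcs s t {p, q, a} (insert w {p, q, a}))))) := by
  have hpq := h.pq
  have hpa := h.pa
  have hqa := h.qa
  have hqp : q ≠ p := h.pq.symm
  have hap : a ≠ p := h.pa.symm
  have haq : a ≠ q := h.qa.symm
  simp only [sum_powerset_three hpq hpa hqa, memWt, notMemWt, Finset.mem_insert, Finset.mem_singleton,
    Finset.notMem_empty, hpq, hpa, hqa, hqp, hap, haq, h.nu_a pr h12 h13 h14 h23 h24 h34]
  simp only [or_self, or_false, or_true, if_true, if_false, mul_one, mul_zero, zero_mul, add_zero,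
    zero_add]
  ring

/-- **THEOREM (row 2′DARC over the undirected square with the tail at the OR-vertex, every
head).**  Hypotheses: a mixed system (`SameEnds`), the square core `SquareCore arcs s p q a c₁ c₂
c₃ c₄` with four distinct coins, `t, w ∉ {s, p, q, a}`, and the two reduced cell masses positive
(`M₀ = P(R_{t,a})`, `M' = P(gate ∩ {a ∈ S⁺})`, as the core sums).  Conclusion:
`Φ_D({s ↛ t in D + (a → w)}) ≥ 0` for the markers `p, q`. -/
theorem darc_of_squareCore (pr : E → R) (hp : IsProbVec pr) (hS : SameEnds arcs)
    (h : SquareCore arcs s p q a c₁ c₂ c₃ c₄)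
    (h12 : c₁ ≠ c₂) (h13 : c₁ ≠ c₃) (h14 : c₁ ≠ c₄) (h23 : c₂ ≠ c₃) (h24 : c₂ ≠ c₄) (h34 : c₃ ≠ c₄)
    {t : V} (htC : t ∉ ({p, q, a} : Finset V)) (hts : t ≠ s) (hws : w ≠ s)
    (hwC : w ∉ ({p, q, a} : Finset V))
    (hM₀ : 0 < ∑ W ∈ ({p, q, a} : Finset V).powerset, prob pr (coreLevel arcs s {p, q, a} W) *
      notMemWt a W * prob pr (coreAvoidEvent arcs s t {p, q, a} W))
    (hM' : 0 < ∑ W ∈ ({p, q, a} : Finset V).powerset, prob pr (coreLevel arcs s {p, q, a} W) *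
      memWt a W * prob pr (coreAvoidEvent arcs s t {p, q, a} (insert w W))) :
    DARC pr arcs s {t} p q a w := by
  have hC := h.closedInCoreU
  refine darc_of_uCellBracketU pr hp hS hC htC hts (by simp) (by simp) (by simp) hws hwC ?_ hM₀ hM'
  rw [h.bracket_sums_eq pr h12 h13 h14 h23 h24 h34 t]
  -- the distinctness facts
  have hpq := h.pq
  have hpa := h.pa
  have hqa := h.qa
  have hqp : q ≠ p := h.pq.symm
  have hap : a ≠ p := h.pa.symm
  have haq : a ≠ q := h.qa.symm
  have hwp : w ≠ p := fun e => hwC (by simp [e])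
  have hwq : w ≠ q := fun e => hwC (by simp [e])
  have hwa : w ≠ a := fun e => hwC (by simp [e])
  -- the head function and its properties
  set A : Finset V → R := fun X => prob pr (coreAvoidEvent arcs s t {p, q, a} X) with hA
  have hA0 : ∀ X, 0 ≤ A X := fun X => prob_nonneg hp _
  have hAmono : ∀ X Y : Finset V, X ⊆ Y → A Y ≤ A X := by
    intro X Y hXY
    simp only [hA]
    apply prob_mono hp
    intro ω hω v hv
    exact hω v (Finset.insert_subset_insert s hXY hv)
  have hAlsm : ∀ X Y : Finset V, A X * A Y ≤ A (X ∩ Y) * A (X ∪ Y) := by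
    intro X Y
    have hh := vdBKC_rev pr hp (sameEnds_coreOff (C := ({p, q, a} : Finset V)) hS) t ∅ ∅
      (insert s X) (insert s Y)
    have hi : insert s X ∩ insert s Y = insert s (X ∩ Y) := (Finset.insert_inter_distrib X Y s).symm
    have hun : insert s X ∪ insert s Y = insert s (X ∪ Y) := (Finset.insert_union_distrib s X Y).symm
    rw [hi, hun] at hh
    simp only [hA, coreAvoidEvent]
    simpa only [Finset.notMem_empty, false_imp_iff, implies_true, Set.setOf_true, Set.univ_inter,
      Finset.empty_union] using hh
  have hl : ∀ X Y Z U : Finset V, X ∩ Y = Z → X ∪ Y = U → A X * A Y ≤ A Z * A U := by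
    intro X Y Z U hZ hU
    rw [← hZ, ← hU]; exact hAlsm X Y
  have hOR := h.or_nonneg pr hp h12 h13 h14 h23 h24 h34 A hA0
    (hAmono _ _ (Finset.empty_subset _)) (hAmono _ _ (by simp)) (hAmono _ _ (Finset.empty_subset _))
    (hAmono _ _ (by simp)) (hAmono _ _ (Finset.empty_subset _))
    (square_step1 A hl hpq hpa hqa hqp hap haq hwp hwq hwa)
    (square_step2 A hl hpq hpa hqa hqp hap haq hwp hwq hwa)
    (square_step3 A hl hpq hpa hqa hqp hap haq hwp hwq hwa)
    (square_step4 A hl hpq hpa hqa hqp hap haq hwp hwq hwa)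
    (square_step5 A hl hpq hpa hqa hqp hap haq hwp hwq hwa)
    (square_step6 A hl hpq hpa hqa hqp hap haq hwp hwq hwa)
    (square_step7 A hl hpq hpa hqa hqp hap haq hwp hwq hwa)
    (square_step8 A hl hpq hpa hqa hqp hap haq hwp hwq hwa)
  have hM'' : 0 ≤ prob pr (coreLevel arcs s {p, q, a} {p, a}) * A (insert w {p, a}) + prob pr (coreLevel arcs s {p, q, a} {q, a}) * A (insert w {q, a})
      + prob pr (coreLevel arcs s {p, q, a} {p, q, a}) * A (insert w {p, q, a}) :=
    add_nonneg (add_nonneg (mul_nonneg (prob_nonneg hp _) (hA0 _)) (mul_nonneg (prob_nonneg hp _) (hA0 _)))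
      (mul_nonneg (prob_nonneg hp _) (hA0 _))
  have key := square_bracket_of_or (prob pr (coreLevel arcs s {p, q, a} ∅)) (prob pr (coreLevel arcs s {p, q, a} {p})) (prob pr (coreLevel arcs s {p, q, a} {q})) (prob pr (coreLevel arcs s {p, q, a} {p, q})) (prob pr (coreLevel arcs s {p, q, a} {p, a})) (prob pr (coreLevel arcs s {p, q, a} {q, a})) (prob pr (coreLevel arcs s {p, q, a} {p, q, a}))
    (A ∅) (A {p}) (A {q}) (A {p, q}) (A {p, a}) (A {q, a}) (A {p, q, a}) (A (insert w {p, a}))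
    (A (insert w {q, a})) (A (insert w {p, q, a})) hM'' hOR
  simpa only [hA] using key

end SquareMain

end Summit.Ventures.PercRepro2.Coin
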